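import Literature.NumberTheory.EllipticCurves.Kato2004.EulerSystemValues
import Literature.NumberTheory.GaloisRepresentations.ContinuousH1AddHomAlgebraProofs
import Literature.NumberTheory.EllipticCurves.IsogenyFrobeniusTraceProofs
import HarnessLib

/-!
# Kato 2004 (Astérisque 295) §8.1 / §13.1 with Rubin, *Euler Systems* Def. 2.1.1: an isogeny of elliptic
# curves TRANSPORTS Euler systems — the push-forward `T_p φ` on the continuous cohomology `H¹(F, T_pW)`,
# its compatibility with restriction / corestriction / the Galois action, the isogeny-invariance of
# Rubin's Euler factor `P(Fr_q⁻¹ | T*; X)`, and `IsEulerSystem` along `φ`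

Topic `NumberTheory/EllipticCurves`, sub-directory `Kato2004` (namespace = path).  Cell `bsd-potss`, seat
`bsd-potss-rkm` (g14), crux M = item stmt-BirchSwinnertonDyer-19196 `ReducibleKatoMember` of the routes
`KatoDescentPotSupersingular` (K9) / `KatoDescentTamePotSupersingular` (K8-t′).  PURPOSE: the cell's Kato facts at
"Kato's member" (`exists_member_eulerSystem_expStar_values`, `exists_memberHullZetaInputs`) display the member
`W_K` of the isogeny class EXISTENTIALLY; seat rkm g12 recorded that the one analysis gap in the tightness of the
held zeta package is «Euler system at one member ⟹ at every member» (no isogeny-transport API for `tateRep`).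
This file supplies that API: for a `ℚ`-isogeny `φ : W → W'` of elliptic curves the `ℤ_p`-linear push-forward
`H¹(U, T_pW) → H¹(U, T_pW')` on every level `U ≤ Γ_ℚ` (Mathlib's functoriality of continuous cochain
cohomology in the coefficients, `cohomologyMap`), and the facts that make it a morphism of Euler systems.

## Mathematical content (all folklore / definitional; nothing is asserted as a named fact)

* (T1) `T_p φ : T_pW → T_pW'` (`TateModule.map`, Silverman *AEC* III.7.4) is continuous, `ℤ_p`-linear and
  `Γ_ℚ`-equivariant (`Literature.AlgebraicGeometry.Motives.tateModule_map_smul`), hence a morphism of the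
  topological representations `tateRep W p → tateRep W' p` restricted to any `U ≤ Γ_ℚ` (`tateRepHomSub`).
* (T2) The induced map `φ_* : H¹(U, T_pW) → H¹(U, T_pW')` (`isogenyMapH1`) commutes with restriction,
  corestriction and the conjugation action of `Γ_ℚ` (Serre, *Galois Cohomology* I §2.4: `res`, `cor` and the
  `G/H`-action are morphisms of cohomological functors in the coefficient module) — from the tree's
  `mapH1AddHom_resLe / _coresLe / _conjMap` through `cohomologyMap_one_eq_mapH1AddHom`.
* (T3) If `ψ ∘ φ = [n]` on `W(ℚ̄)` (the dual isogeny, *AEC* III.6.1) then `ψ_* ∘ φ_* = n` on `H¹(U, T_pW)`.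
* (T4) Rubin's Euler factor `P(σ⁻¹ | T*; X) = det(1 − χ(σ)⁻¹σX | T)` (`rubinEulerFactor`, Rubin Def. 2.1.1) is the
  SAME polynomial in `ℤ_p[X]` for `T = T_pW` and `T = T_pW'` and every `σ ∈ Γ_ℚ`: `V_pφ` is a `ℚ_p[Γ_ℚ]`-isomorphism
  (`Isogeny.baseChange_tateModule_map_bijective`, Faltings' Kor. 2 (i) ⇒ (ii) for elliptic curves), characteristic
  polynomials are conjugation-invariant and commute with base change, and `ℤ_p[X] → ℚ_p[X]` is injective; so
  `φ_*` intertwines the operators `P(Fr_q⁻¹ | T*; Fr_q⁻¹)` (`eulerFactorOp`) on the two cohomologies.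
* (T5) Consequently the push-forward of an Euler system for `T_pW` over any system of levels `L`
  (`IsEulerSystem`, Rubin Def. 2.1.1 / Kato (13.1.1)) is an Euler system for `T_pW'` (`IsEulerSystem.isogenyMap`):
  "`ES(T)` is functorial in `T`".

Companion: `EulerSystemIsogenyTransportZeta.lean` (transport of Kato's `ZetaBody` data, dual-exponential datum
included).  HONEST FRAMING: infrastructure only; no Literature fact is added or discharged; BSD is not advanced.

## References

* K. Rubin, *Euler Systems*, Ann. of Math. Stud. 147 (2000), Ch. II §1 = Def. 2.1.1 (the module `ES(T)`; the
  Euler factor `P(Fr_q⁻¹ | T*; x)`), Ch. I §2 and App. B §2 (continuous cohomology). [Rubin2000]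
* K. Kato, Astérisque 295 (2004), (8.1.3) (p. 180), §13.1 (13.1.1) and Ex. 13.3 (pp. 224–225): the zeta elements
  form an Euler system for ANY stable lattice `T` of `V_{F_λ}(f)`. [Kato2004Asterisque]
* J.-P. Serre, *Galois Cohomology* (1997), I §2.2, §2.4 (functoriality; compatibility of `res`/`cor`).
  [SerreGaloisCohomology1997]
* J. H. Silverman, *AEC* (2009), III.6.1 (dual isogeny), III.7.4 (`T_ℓ φ`). [SilvermanAEC2009]
* G. Faltings, Invent. Math. 73 (1983), §5 Kor. 2. [Faltings1983Endlichkeit]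
* Tree: `Kato2004/EulerSystemValues.lean` (`tateRep`), `GaloisRepresentations/EulerSystem.lean` (`H1`,
  `frobeniusInvOp`, `eulerFactorOp`, `IsEulerSystem`), `Kato2004/IwasawaH1Reduction.lean` (`mapH1AddHom` and its
  compatibilities), `GaloisRepresentations/ContinuousH1AddHomAlgebraProofs.lean`
  (`cohomologyMap_one_eq_mapH1AddHom`), `IsogenyFrobeniusTraceProofs.lean` (`V_pφ` bijective and equivariant).
-/

noncomputable section

open scoped NumberField TensorProduct Polynomial
open CategoryTheory Field IsDedekindDomain
open Literature.NumberTheory.GaloisRepresentations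
open Literature.NumberTheory.EllipticCurves Literature.NumberTheory.EllipticCurves.Kato2004
open Literature.NumberTheory.EllipticCurves.Kato2004.EulerSystemValues

namespace Literature.NumberTheory.EllipticCurves.Kato2004

/-! ## §1 The push-forward `φ_* : H¹(U, T_pW) → H¹(U, T_pW')` of a `ℚ`-isogeny -/

section PushForward

variable {W W' W'' : WeierstrassCurve ℚ} [W.IsElliptic] [W'.IsElliptic] [W''.IsElliptic] (p : ℕ) [Fact p.Prime]
  [ContinuousSMul ℤ_[p] (W.tateModule p)] [ContinuousSMul ℤ_[p] (W'.tateModule p)]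
  [ContinuousSMul ℤ_[p] (W''.tateModule p)]

omit [W.IsElliptic] [W'.IsElliptic] [ContinuousSMul ℤ_[p] (W.tateModule p)]
  [ContinuousSMul ℤ_[p] (W'.tateModule p)] in
/-- `T_p f : T_pW → T_pW'` is continuous for the profinite topologies (coordinatewise a map between discrete
sets). [cite: SilvermanAEC2009, III.7.4] -/
theorem continuous_tateModule_map (f : W.geomPoints →+ W'.geomPoints) :
    Continuous (TateModule.map p f) := by
  refine continuous_induced_rng.2 (continuous_pi fun n => ?_)
  change Continuous fun x : W.tateModule p => TateModule.proj p n (TateModule.map p f x)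
  simp only [TateModule.proj_map]
  exact continuous_of_discreteTopology.comp (TateModule.continuous_proj n)

/-- **`T_p φ` as a morphism of topological representations of the level group `U ≤ Γ_ℚ`**:
`T_pW|_U → T_pW'|_U`, continuous `ℤ_p`-linear and `U`-equivariant. [cite: SilvermanAEC2009, III.7.4] -/
def tateRepHomSub (φ : WeierstrassCurve.Isogeny W W') (U : Subgroup (absoluteGaloisGroup ℚ)) :
    subgroupRep (tateRep W p).toTopRep U ⟶ subgroupRep (tateRep W' p).toTopRep U :=
  TopRep.ofHom (ρ := (subgroupRep (tateRep W p).toTopRep U).ρ)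
    (σ := (subgroupRep (tateRep W' p).toTopRep U).ρ)
    ⟨⟨TateModule.map p φ.toAddMonoidHom, continuous_tateModule_map p φ.toAddMonoidHom⟩,
      fun g => ContinuousLinearMap.ext fun x =>
        Literature.AlgebraicGeometry.Motives.tateModule_map_smul p φ (g : absoluteGaloisGroup ℚ) x⟩

/-- **The push-forward `φ_* : H¹(U, T_pW) →ₗ[ℤ_p] H¹(U, T_pW')`** of a `ℚ`-isogeny `φ : W → W'` on the
continuous cohomology of every `U ≤ Γ_ℚ` (functoriality of `H¹_cont(U, –)` in the coefficients,
`[θ] ↦ [T_pφ ∘ θ]`). [cite: SerreGaloisCohomology1997, I §2.2] [cite: Rubin2000, Def. 2.1.1] -/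
def isogenyMapH1 (φ : WeierstrassCurve.Isogeny W W') (U : Subgroup (absoluteGaloisGroup ℚ)) :
    H1 (tateRep W p) U →ₗ[ℤ_[p]] H1 (tateRep W' p) U :=
  (cohomologyMap (tateRepHomSub p φ U) 1).hom.toLinearMap

/-- `φ_*` is the tree's `mapH1AddHom` of the additive map `T_pφ`. [cite: SerreGaloisCohomology1997, I §2.2] -/
theorem isogenyMapH1_eq_mapH1AddHom (φ : WeierstrassCurve.Isogeny W W')
    (U : Subgroup (absoluteGaloisGroup ℚ)) (c : H1 (tateRep W p) U) :
    isogenyMapH1 p φ U c =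
      mapH1AddHom (subgroupRep (tateRep W p).toTopRep U) (subgroupRep (tateRep W' p).toTopRep U)
        (TateModule.map p φ.toAddMonoidHom).toAddMonoidHom (continuous_tateModule_map p φ.toAddMonoidHom)
        (fun g x => Literature.AlgebraicGeometry.Motives.tateModule_map_smul p φ
          (g : absoluteGaloisGroup ℚ) x) c :=
  cohomologyMap_one_eq_mapH1AddHom _ _ _ c

/-- `φ_*` on an explicit crossed homomorphism: `φ_* [θ] = [T_pφ ∘ θ]`. [cite: SerreGaloisCohomology1997, I §2.2] -/
theorem isogenyMapH1_oneCocycleClass (φ : WeierstrassCurve.Isogeny W W')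
    (U : Subgroup (absoluteGaloisGroup ℚ)) (θ : contOneCocycles (subgroupRep (tateRep W p).toTopRep U)) :
    isogenyMapH1 p φ U (oneCocycleClass _ θ) =
      oneCocycleClass (subgroupRep (tateRep W' p).toTopRep U)
        (contOneCocycles.pushAddHom (X := subgroupRep (tateRep W p).toTopRep U)
          (Y := subgroupRep (tateRep W' p).toTopRep U) (TateModule.map p φ.toAddMonoidHom).toAddMonoidHom
          (continuous_tateModule_map p φ.toAddMonoidHom)
          (fun g x => Literature.AlgebraicGeometry.Motives.tateModule_map_smul p φ
            (g : absoluteGaloisGroup ℚ) x) θ) := by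
  rw [isogenyMapH1_eq_mapH1AddHom, mapH1AddHom_oneCocycleClass]

/-- **`φ_*` commutes with restriction** `res : H¹(U', T) → H¹(U, T)` (`U ≤ U'`).
[cite: SerreGaloisCohomology1997, I §2.4] -/
theorem isogenyMapH1_resLe (φ : WeierstrassCurve.Isogeny W W') {U U' : Subgroup (absoluteGaloisGroup ℚ)}
    (h : U ≤ U') (c : H1 (tateRep W p) U') :
    isogenyMapH1 p φ U (resLe (tateRep W p).toTopRep h 1 c) =
      resLe (tateRep W' p).toTopRep h 1 (isogenyMapH1 p φ U' c) := by
  rw [isogenyMapH1_eq_mapH1AddHom, isogenyMapH1_eq_mapH1AddHom]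
  exact mapH1AddHom_resLe _ _ h _ _ c

/-- **`φ_*` commutes with corestriction** `cor : H¹(U, T) → H¹(U', T)` (`U ≤ U'`, `U` open of finite index).
[cite: SerreGaloisCohomology1997, I §2.4] -/
theorem isogenyMapH1_coresLe (φ : WeierstrassCurve.Isogeny W W') {U U' : Subgroup (absoluteGaloisGroup ℚ)}
    (h : U ≤ U') (hUo : IsOpen (U : Set (absoluteGaloisGroup ℚ))) [hF : Fintype (U' ⧸ U.subgroupOf U')]
    (c : H1 (tateRep W p) U) :
    isogenyMapH1 p φ U' (coresLe (tateRep W p).toTopRep h hUo c) =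
      coresLe (tateRep W' p).toTopRep h hUo (isogenyMapH1 p φ U c) := by
  rw [isogenyMapH1_eq_mapH1AddHom, isogenyMapH1_eq_mapH1AddHom]
  exact mapH1AddHom_coresLe _ _ h hUo _ _ c

/-- **`φ_*` commutes with the conjugation action** of `σ ∈ Γ_ℚ` on `H¹(U, T)` (`U` normal).
[cite: SerreGaloisCohomology1997, I §2.4] -/
theorem isogenyMapH1_conjMap (φ : WeierstrassCurve.Isogeny W W') (U : Subgroup (absoluteGaloisGroup ℚ))
    [U.Normal] (σ : absoluteGaloisGroup ℚ) (c : H1 (tateRep W p) U) :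
    isogenyMapH1 p φ U (conjMap (tateRep W p).toTopRep U σ 1 c) =
      conjMap (tateRep W' p).toTopRep U σ 1 (isogenyMapH1 p φ U c) := by
  rw [isogenyMapH1_eq_mapH1AddHom, isogenyMapH1_eq_mapH1AddHom]
  exact mapH1AddHom_conjMap _ _
    (fun g x => Literature.AlgebraicGeometry.Motives.tateModule_map_smul p φ g x) σ _ c

/-- `φ_*` commutes with Rubin's operator `Fr_q⁻¹` (`frobeniusInvOp`, the action of `σ⁻¹`).
[cite: Rubin2000, Def. 2.1.1] -/
theorem isogenyMapH1_frobeniusInvOp (φ : WeierstrassCurve.Isogeny W W') (U : Subgroup (absoluteGaloisGroup ℚ))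
    [U.Normal] (σ : absoluteGaloisGroup ℚ) (c : H1 (tateRep W p) U) :
    isogenyMapH1 p φ U (frobeniusInvOp (tateRep W p) U σ c) =
      frobeniusInvOp (tateRep W' p) U σ (isogenyMapH1 p φ U c) :=
  isogenyMapH1_conjMap p φ U σ⁻¹ c

/-- **Dual isogeny on cohomology (T3)**: if `ψ ∘ φ = [n]` on `W(ℚ̄)` then `ψ_* (φ_* c) = n • c` on
`H¹(U, T_pW)` (`T_p` is a functor and `T_p[n] = n`). [cite: SilvermanAEC2009, Thm. III.6.1 (a) and III.7.4] -/
theorem isogenyMapH1_isogenyMapH1_of_comp_eq_zsmul (φ : WeierstrassCurve.Isogeny W W')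
    (ψ : WeierstrassCurve.Isogeny W' W) {n : ℤ} (hψφ : ∀ P, ψ (φ P) = n • P)
    (U : Subgroup (absoluteGaloisGroup ℚ)) (c : H1 (tateRep W p) U) :
    isogenyMapH1 p ψ U (isogenyMapH1 p φ U c) = n • c := by
  obtain ⟨θ, rfl⟩ := oneCocycleClass_surjective _ c
  have hzs : oneCocycleClass (subgroupRep (tateRep W p).toTopRep U) (n • θ) =
      n • oneCocycleClass (subgroupRep (tateRep W p).toTopRep U) θ :=
    map_zsmul (oneCocycleClassₗ (subgroupRep (tateRep W p).toTopRep U)) n θ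
  rw [isogenyMapH1_oneCocycleClass, isogenyMapH1_oneCocycleClass, ← hzs]
  refine congrArg _ (Subtype.ext (ContinuousMap.ext fun g => ?_))
  rw [contOneCocycles.pushAddHom_apply, contOneCocycles.pushAddHom_apply, AddSubgroupClass.coe_zsmul,
    ContinuousMap.zsmul_apply]
  change TateModule.map p ψ.toAddMonoidHom (TateModule.map p φ.toAddMonoidHom (θ.1 g)) = n • θ.1 g
  refine TateModule.ext fun k => ?_
  rw [TateModule.proj_map, TateModule.proj_map, map_zsmul]
  exact hψφ _

end PushForward

/-! ## §2 Rubin's Euler factor is an isogeny invariant (T4) -/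

section EulerFactor

/-- The characteristic polynomial of the transpose (dual map) of an endomorphism of a finite free module
equals that of the endomorphism (`det(X − Aᵀ) = det(X − A)`). [folklore] -/
private theorem charpoly_dualMap_eq {R : Type*} [CommRing R] {M : Type*} [AddCommGroup M] [Module R M]
    [Module.Free R M] [Module.Finite R M] (f : Module.End R M) : f.dualMap.charpoly = f.charpoly := by
  classical
  let b := Module.Free.chooseBasis R M
  rw [← f.charpoly_toMatrix b, ← f.dualMap.charpoly_toMatrix b.dualBasis, LinearMap.dualMap_def,
    LinearMap.toMatrix_transpose, Matrix.charpoly_transpose]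

/-- The dual map of a scalar multiple: `(c • f)ᵀ = c • fᵀ`. [folklore] -/
private theorem dualMap_smul_eq {R : Type*} [CommRing R] {M : Type*} [AddCommGroup M] [Module R M] (c : R)
    (f : Module.End R M) : (c • f).dualMap = c • f.dualMap := by
  refine LinearMap.ext fun g => LinearMap.ext fun m => ?_
  simp only [LinearMap.dualMap_apply, LinearMap.smul_apply, map_smul, smul_eq_mul]

/-- Polynomials in intertwined operators are intertwined: `g ∘ F = F' ∘ g ⟹ g ∘ P(F) = P(F') ∘ g`.
[folklore] -/
private theorem apply_aeval_of_semiconj {R : Type*} [CommRing R] {M M' : Type*} [AddCommGroup M] [Module R M]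
    [AddCommGroup M'] [Module R M'] (g : M →ₗ[R] M') (F : Module.End R M) (F' : Module.End R M')
    (h : ∀ x, g (F x) = F' (g x)) (P : R[X]) (x : M) :
    g (Polynomial.aeval F P x) = Polynomial.aeval F' P (g x) := by
  induction P using Polynomial.induction_on generalizing x with
  | C a =>
    rw [Polynomial.aeval_C, Polynomial.aeval_C, Module.algebraMap_end_apply, Module.algebraMap_end_apply,
      map_smul]
  | add P Q hP hQ => rw [map_add, map_add, LinearMap.add_apply, LinearMap.add_apply, map_add, hP, hQ]
  | monomial k a ih =>
    rw [pow_succ, ← mul_assoc, map_mul (Polynomial.aeval F) _ Polynomial.X,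
      map_mul (Polynomial.aeval F') _ Polynomial.X, Module.End.mul_apply, Module.End.mul_apply,
      Polynomial.aeval_X, Polynomial.aeval_X, ih, h]

variable {W W' : WeierstrassCurve ℚ} [W.IsElliptic] [W'.IsElliptic] (p : ℕ) [Fact p.Prime]
  [ContinuousSMul ℤ_[p] (W.tateModule p)] [ContinuousSMul ℤ_[p] (W'.tateModule p)]
  [Module.Free ℤ_[p] (W.tateModule p)] [Module.Finite ℤ_[p] (W.tateModule p)]
  [Module.Free ℤ_[p] (W'.tateModule p)] [Module.Finite ℤ_[p] (W'.tateModule p)]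

omit [ContinuousSMul ℤ_[p] (W.tateModule p)] [ContinuousSMul ℤ_[p] (W'.tateModule p)] in
/-- **Characteristic polynomials of intertwined operators on isogenous Tate modules agree**: for a
`ℚ`-isogeny `φ : W → W'` and `ℤ_p`-linear `B ∈ End(T_pW)`, `B' ∈ End(T_pW')` with `T_pφ ∘ B = B' ∘ T_pφ`,
`charpoly B = charpoly B'` in `ℤ_p[X]` — `V_pφ` is bijective (Faltings Kor. 2 (i) ⇒ (ii), elliptic case), so it
conjugates the base changes to `ℚ_p`, and `ℤ_p[X] ↪ ℚ_p[X]`. [cite: Faltings1983Endlichkeit, §5 Korollar 2, (i) ⇒ (ii)]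
[cite: SilvermanAEC2009, III.7.4] -/
theorem charpoly_eq_of_isogeny_semiconj (φ : WeierstrassCurve.Isogeny W W')
    (B : Module.End ℤ_[p] (W.tateModule p)) (B' : Module.End ℤ_[p] (W'.tateModule p))
    (h : ∀ x, TateModule.map p φ.toAddMonoidHom (B x) = B' (TateModule.map p φ.toAddMonoidHom x)) :
    B.charpoly = B'.charpoly := by
  have hp : ((p : ℕ) : ℚ) ≠ 0 := by exact_mod_cast (Fact.out : p.Prime).ne_zero
  apply Polynomial.map_injective (algebraMap ℤ_[p] ℚ_[p]) (IsFractionRing.injective ℤ_[p] ℚ_[p])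
  rw [← LinearMap.charpoly_baseChange, ← LinearMap.charpoly_baseChange]
  have hc : (TateModule.map p φ.toAddMonoidHom).comp B = B'.comp (TateModule.map p φ.toAddMonoidHom) :=
    LinearMap.ext h
  have key : ((TateModule.map p φ.toAddMonoidHom).baseChange ℚ_[p]).comp (B.baseChange ℚ_[p]) =
      (B'.baseChange ℚ_[p]).comp ((TateModule.map p φ.toAddMonoidHom).baseChange ℚ_[p]) := by
    rw [← LinearMap.baseChange_comp, ← LinearMap.baseChange_comp, hc]
  let e : ℚ_[p] ⊗[ℤ_[p]] W.tateModule p ≃ₗ[ℚ_[p]] ℚ_[p] ⊗[ℤ_[p]] W'.tateModule p :=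
    LinearEquiv.ofBijective ((TateModule.map p φ.toAddMonoidHom).baseChange ℚ_[p])
      (φ.baseChange_tateModule_map_bijective p hp)
  have hconj : e.conj (B.baseChange ℚ_[p]) = B'.baseChange ℚ_[p] := by
    refine LinearMap.ext fun v => ?_
    obtain ⟨w, rfl⟩ := e.surjective v
    rw [LinearEquiv.conj_apply, LinearMap.comp_apply, LinearMap.comp_apply, LinearEquiv.coe_coe,
      LinearEquiv.coe_coe, e.symm_apply_apply]
    exact LinearMap.congr_fun key w
  rw [← hconj, LinearEquiv.charpoly_conj]

omit [ContinuousSMul ℤ_[p] (W.tateModule p)] [ContinuousSMul ℤ_[p] (W'.tateModule p)] in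
/-- **The characteristic polynomial of `c • ρ(σ)` on the Tate module is an isogeny invariant**: for a
`ℚ`-isogeny `φ : W → W'`, every `σ ∈ Γ_ℚ` and `c ∈ ℤ_p`, `charpoly (c • ρ_W(σ) | T_pW) = charpoly (c • ρ_{W'}(σ) | T_pW')`
in `ℤ_p[X]` (`T_pφ` is `Γ_ℚ`-equivariant). [cite: Faltings1983Endlichkeit, §5 Korollar 2, (i) ⇒ (ii)]
[cite: SilvermanAEC2009, III.7.4] -/
theorem charpoly_smul_galoisRepTate_eq_of_isogeny (φ : WeierstrassCurve.Isogeny W W') (c : ℤ_[p])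
    (σ : absoluteGaloisGroup ℚ) :
    (c • W.galoisRepTate p σ).charpoly = (c • W'.galoisRepTate p σ).charpoly :=
  charpoly_eq_of_isogeny_semiconj p φ _ _ fun x ↦ by
    rw [LinearMap.smul_apply, LinearMap.smul_apply, map_smul, WeierstrassCurve.galoisRepTate_apply_apply,
      WeierstrassCurve.galoisRepTate_apply_apply, Literature.AlgebraicGeometry.Motives.tateModule_map_smul]

omit [ContinuousSMul ℤ_[p] (W.tateModule p)] [ContinuousSMul ℤ_[p] (W'.tateModule p)] in
/-- **Rubin's Euler factor `P(σ⁻¹ | T*; X)` is the same for `T = T_pW` and `T = T_pW'`** (`W`, `W'` `ℚ`-isogenous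
elliptic curves, any `σ ∈ Γ_ℚ`, any character `χ`): it is the reversed characteristic polynomial of
`χ(σ)⁻¹ ρ(σ)ᵀ`, and `charpoly` is transpose- and isogeny-invariant. [cite: Rubin2000, Def. 2.1.1]
[cite: Faltings1983Endlichkeit, §5 Korollar 2, (i) ⇒ (ii)] -/
theorem rubinEulerFactor_tateRep_eq_of_isogeny (φ : WeierstrassCurve.Isogeny W W')
    (χ : absoluteGaloisGroup ℚ →* ℤ_[p]ˣ) (σ : absoluteGaloisGroup ℚ) :
    rubinEulerFactor (W.galoisRepTate p) χ σ = rubinEulerFactor (W'.galoisRepTate p) χ σ := by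
  rw [rubinEulerFactor_eq, rubinEulerFactor_eq, ← dualMap_smul_eq, ← dualMap_smul_eq, charpoly_dualMap_eq,
    charpoly_dualMap_eq, charpoly_smul_galoisRepTate_eq_of_isogeny p φ]

/-- **`φ_*` intertwines the Euler-factor operators** `P(Fr_q⁻¹ | T_pW*; Fr_q⁻¹)` and
`P(Fr_q⁻¹ | T_pW'*; Fr_q⁻¹)` (`eulerFactorOp`) on `H¹(U, ·)`: same polynomial (T4), intertwined `Fr_q⁻¹` (T2).
[cite: Rubin2000, Def. 2.1.1] -/
theorem isogenyMapH1_eulerFactorOp (φ : WeierstrassCurve.Isogeny W W') (U : Subgroup (absoluteGaloisGroup ℚ))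
    [U.Normal] (σ : absoluteGaloisGroup ℚ) (c : H1 (tateRep W p) U) :
    isogenyMapH1 p φ U (eulerFactorOp (tateRep W p) U p σ c) =
      eulerFactorOp (tateRep W' p) U p σ (isogenyMapH1 p φ U c) := by
  unfold eulerFactorOp
  have hT : (tateRep W p).toRepresentation = W.galoisRepTate p := rfl
  have hT' : (tateRep W' p).toRepresentation = W'.galoisRepTate p := rfl
  rw [hT, hT', rubinEulerFactor_tateRep_eq_of_isogeny p φ]
  exact apply_aeval_of_semiconj _ _ _ (isogenyMapH1_frobeniusInvOp p φ U σ) _ c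

end EulerFactor

/-! ## §3 `ES(T)` is functorial in `T`: push-forward of an Euler system (T5) -/

section EulerSystemMap

variable {ι : Type*} [Preorder ι] [OrderBot ι]
variable {W W' : WeierstrassCurve ℚ} [W.IsElliptic] [W'.IsElliptic] (p : ℕ) [Fact p.Prime]
  [ContinuousSMul ℤ_[p] (W.tateModule p)] [ContinuousSMul ℤ_[p] (W'.tateModule p)]
  [Module.Free ℤ_[p] (W.tateModule p)] [Module.Finite ℤ_[p] (W.tateModule p)]
  [Module.Free ℤ_[p] (W'.tateModule p)] [Module.Finite ℤ_[p] (W'.tateModule p)]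

omit [Module.Free ℤ_[p] (W.tateModule p)] [Module.Finite ℤ_[p] (W.tateModule p)]
  [Module.Free ℤ_[p] (W'.tateModule p)] [Module.Finite ℤ_[p] (W'.tateModule p)] in
/-- `φ_*` commutes with the corestriction in the `K_∞`-direction of a system of levels.
[cite: Rubin2000, Def. 2.1.1] -/
theorem isogenyMapH1_coresP (L : EulerSystemLevels ℚ ι) (φ : WeierstrassCurve.Isogeny W W') {i j : ι}
    (hij : i ≤ j) (r : Finset (HeightOneSpectrum (𝓞 ℚ))) (c : H1 (tateRep W p) (L.level j r)) :
    isogenyMapH1 p φ (L.level i r) (L.coresP (tateRep W p) hij r c) =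
      L.coresP (tateRep W' p) hij r (isogenyMapH1 p φ (L.level j r) c) := by
  unfold EulerSystemLevels.coresP
  exact isogenyMapH1_coresLe (hF := Fintype.ofFinite _) p φ _ _ c

omit [Module.Free ℤ_[p] (W.tateModule p)] [Module.Finite ℤ_[p] (W.tateModule p)]
  [Module.Free ℤ_[p] (W'.tateModule p)] [Module.Finite ℤ_[p] (W'.tateModule p)] in
/-- `φ_*` commutes with the corestriction in the tame direction of a system of levels.
[cite: Rubin2000, Def. 2.1.1] -/
theorem isogenyMapH1_coresCons (L : EulerSystemLevels ℚ ι) (φ : WeierstrassCurve.Isogeny W W') (i : ι)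
    (r : L.Ideals) (q : HeightOneSpectrum (𝓞 ℚ)) (hq : q ∈ L.primes)
    (c : H1 (tateRep W p) (L.level i (r.cons q hq).1)) :
    isogenyMapH1 p φ (L.level i r.1) (L.coresCons (tateRep W p) i r q hq c) =
      L.coresCons (tateRep W' p) i r q hq (isogenyMapH1 p φ (L.level i (r.cons q hq).1) c) := by
  unfold EulerSystemLevels.coresCons
  exact isogenyMapH1_coresLe (hF := Fintype.ofFinite _) p φ _ _ c

/-- **An isogeny transports Euler systems (T5)**: if `(z_{i,r})` is an Euler system for `T_pW` over the levels
`L` (Rubin Def. 2.1.1 / Kato (13.1.1)), then `(φ_* z_{i,r})` is an Euler system for `T_pW'` — `φ_*` commutes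
with both corestrictions and intertwines the Euler-factor operators, which are given by the SAME polynomial.
[cite: Rubin2000, Def. 2.1.1 and Remark 2.1.4] [cite: Kato2004Asterisque, §13.1 (13.1.1) and Ex. 13.3 (pp. 224–225)] -/
theorem IsEulerSystem.isogenyMap (L : EulerSystemLevels ℚ ι) (φ : WeierstrassCurve.Isogeny W W')
    {z : ∀ (i : ι) (r : L.Ideals), H1 (tateRep W p) (L.level i r.1)}
    (hz : IsEulerSystem L (tateRep W p) p z) :
    IsEulerSystem L (tateRep W' p) p (fun i r ↦ isogenyMapH1 p φ (L.level i r.1) (z i r)) where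
  cores_p hij r := by rw [← isogenyMapH1_coresP, hz.cores_p hij r]
  cores_cons_of_unramified i r q hq hqr hur := by
    rw [← isogenyMapH1_coresCons, hz.cores_cons_of_unramified i r q hq hqr hur]
  cores_cons i r q hq hqr hram σ hσ := by
    rw [← isogenyMapH1_coresCons, hz.cores_cons i r q hq hqr hram σ hσ, isogenyMapH1_eulerFactorOp]

end EulerSystemMap

end Literature.NumberTheory.EllipticCurves.Kato2004

end
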